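import Mathlib
import Literature.NumberTheory.GaloisRepresentations.CubicReciprocityRationalPrime
import HarnessLib

/-!
# The CM field `L = K(√-2) = ℚ(√-3, √-2)` over `K = ℚ(ω)` and its involution

Support file for stub `stub_baseChangeToL` of the line `split-ramified-prime-sqrt6` (crux
`Summit.Langlands.Langlands.Theses.PicardMuOrdinary.IrregularClassicality`, stmt-Langlands-13758).
Everything here is PROVED (pure algebra; theorems only, no definitions):

* `K` with `IsCyclotomicExtension {3} ℚ K` (`[K : ℚ] = 2`, tree): a non-trivial automorphism `c₀` is
  an involution whose fixed points are rational; `-2` is not a square in `K` (else `√-2 · √-3 = ±√6`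
  would be a rational square root of `6`); complex conjugation of every embedding `K → ℂ` is `c₀`;
* for a quadratic extension `M/F` generated by `s`: ring homomorphisms out of `M` are determined on
  `F` and `s`; if `s² = -2`, `c ∈ Aut(M/ℚ)` has `c s = -s` and restricts on `F` to the complex
  conjugation `c₀` of `F`, then `c` is complex conjugation for EVERY embedding `M → ℂ`; a totally
  complex `M` with such an involution is CM (fixed field totally real, `IsCMField.ofCMExtension` —
  the argument of Mathlib's `IsCMField.of_forall_isConj` without its Galois hypothesis);
* `exists_cmField_sqrt_neg_two`: for `K = CyclotomicField 3 ℚ` and `c₀ ≠ 1` there is a CM number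
  field `L ⊇ K` with `[L : K] = 2`, `s ∈ L`, `s² = -2`, and an involution `c ∈ Aut(L/ℚ)`, `c s = -s`,
  `c|_K = c₀` (namely `L = K[X]/(X² + 2)`, `AdjoinRoot`).
-/

open IsDedekindDomain NumberField Polynomial
open Literature.NumberTheory.GaloisRepresentations

set_option linter.dupNamespace false -- project-wide: `Summit.Langlands.Langlands` is the mandated namespace

noncomputable section

namespace Summit.Langlands.Langlands.Theorems.IrregularClassicality.SplitRamifiedPrimeSqrt6

/-! ## The base field `K = ℚ(ω)` -/

/-- In a type with two elements, everything is one of two given distinct elements. -/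
theorem eq_or_eq_of_card_eq_two {α : Type*} [Finite α] (h : Nat.card α = 2)
    {a b : α} (hab : a ≠ b) (x : α) : x = a ∨ x = b := by
  classical
  by_contra hx
  push Not at hx
  haveI := Fintype.ofFinite α
  have h3 : ({x, a, b} : Finset α).card = 3 := by
    rw [Finset.card_insert_of_notMem (by simp [hx.1, hx.2]), Finset.card_pair hab]
  have := Finset.card_le_univ ({x, a, b} : Finset α)
  rw [Nat.card_eq_fintype_card] at h
  omega

/-- `6` is not the square of a rational number. -/
theorem rat_sq_ne_six (q : ℚ) : q ^ 2 ≠ 6 := by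
  intro h
  have hirr : Irrational (Real.sqrt ((6 : ℕ) : ℝ)) := by
    rw [irrational_sqrt_natCast_iff]
    rintro ⟨r, hr⟩
    have hr3 : r ≤ 3 := by nlinarith
    interval_cases r <;> omega
  apply hirr
  refine ⟨|q|, ?_⟩
  have h' : ((q : ℝ)) ^ 2 = 6 := by exact_mod_cast h
  rw [Nat.cast_ofNat, ← h', Real.sqrt_sq_eq_abs, Rat.cast_abs]

/-- A complex number with square `-2` is purely imaginary: `conj z = -z`. -/
theorem conj_eq_neg_of_sq_eq_neg_two {z : ℂ} (hz : z ^ 2 = -2) : starRingEnd ℂ z = -z := by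
  have hre : (z ^ 2).re = -2 := by rw [hz]; simp
  have him : (z ^ 2).im = 0 := by rw [hz]; simp
  simp only [sq, Complex.mul_re, Complex.mul_im] at hre him
  have hre0 : z.re = 0 := by
    rcases mul_eq_zero.mp (show z.re * z.im = 0 by linarith) with h | h
    · exact h
    · rw [h] at hre; nlinarith [sq_nonneg z.re]
  apply Complex.ext <;> simp [hre0]

section Cyclotomic

variable {K : Type} [Field K] [NumberField K] [IsCyclotomicExtension {3} ℚ K]

/-- `#Gal(K/ℚ) = 2` (`K/ℚ` is Galois of degree `2`, tree: `finrank_eq_two_of_isCyclotomicExtension_three`). -/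
theorem card_algEquiv_K : Nat.card (K ≃ₐ[ℚ] K) = 2 := by
  haveI : IsGalois ℚ K := IsCyclotomicExtension.isGalois {3} ℚ K
  rw [IsGalois.card_aut_eq_finrank, finrank_eq_two_of_isCyclotomicExtension_three]

/-- `Gal(K/ℚ) = {1, c₀}` for any `c₀ ≠ 1`. -/
theorem algEquiv_K_eq_one_or {c₀ : K ≃ₐ[ℚ] K} (hc₀ : c₀ ≠ 1) (σ : K ≃ₐ[ℚ] K) : σ = 1 ∨ σ = c₀ :=
  eq_or_eq_of_card_eq_two card_algEquiv_K hc₀.symm σ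

/-- `c₀ (c₀ x) = x`: a non-trivial `c₀` is an involution (`c₀² ∈ {1, c₀}`). -/
theorem c₀_c₀_apply {c₀ : K ≃ₐ[ℚ] K} (hc₀ : c₀ ≠ 1) (x : K) : c₀ (c₀ x) = x := by
  have h2 : c₀ * c₀ = 1 := by
    rcases algEquiv_K_eq_one_or hc₀ (c₀ * c₀) with h | h
    · exact h
    · exact absurd (mul_left_cancel (h.trans (mul_one c₀).symm)) hc₀
  rw [← AlgEquiv.mul_apply, h2, AlgEquiv.one_apply]

/-- The fixed points of `c₀ ≠ 1` are rational (`K/ℚ` is Galois with group `{1, c₀}`). -/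
theorem exists_eq_algebraMap_of_c₀_apply_eq {c₀ : K ≃ₐ[ℚ] K} (hc₀ : c₀ ≠ 1) {x : K}
    (hx : c₀ x = x) : ∃ q : ℚ, x = algebraMap ℚ K q := by
  haveI : IsGalois ℚ K := IsCyclotomicExtension.isGalois {3} ℚ K
  have hmem : x ∈ (⊥ : IntermediateField ℚ K) := by
    rw [IsGalois.mem_bot_iff_fixed]
    intro σ
    rcases algEquiv_K_eq_one_or hc₀ σ with rfl | rfl
    · rfl
    · exact hx
  rw [IntermediateField.mem_bot] at hmem
  obtain ⟨q, hq⟩ := hmem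
  exact ⟨q, hq.symm⟩

/-- An element `w₀ = 2ζ + 1` of `K` with `w₀² = -3`. -/
theorem exists_sq_eq_neg_three : ∃ w₀ : K, w₀ ^ 2 = -3 := by
  have hζ := IsCyclotomicExtension.zeta_spec 3 ℚ K
  have h := hζ.isRoot_cyclotomic (by norm_num)
  rw [Polynomial.cyclotomic_three, Polynomial.IsRoot.def] at h
  simp only [eval_add, eval_pow, eval_X, eval_one] at h
  exact ⟨2 * IsCyclotomicExtension.zeta 3 ℚ K + 1, by linear_combination (4 : K) * h⟩

/-- **`-2` is not a square in `K = ℚ(ω)`.**  If `b² = -2` then `c₀ b = ±b`: if `c₀ b = b` then `b` is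
rational with `b² < 0`; if `c₀ b = -b` then, as `w₀² = -3` likewise forces `c₀ w₀ = -w₀`, the product
`b w₀` is `c₀`-fixed hence rational, with square `6` — impossible. -/
theorem sq_ne_neg_two (b : K) : b ^ 2 ≠ -2 := by
  intro hb
  -- a non-trivial automorphism `c₀` (the Galois group has order `2`)
  obtain ⟨c₀, hc₀⟩ : ∃ c₀ : K ≃ₐ[ℚ] K, c₀ ≠ 1 := by
    by_contra h
    push Not at h
    haveI : Subsingleton (K ≃ₐ[ℚ] K) := ⟨fun a b => (h a).trans (h b).symm⟩
    have h1 := Nat.card_of_subsingleton (1 : K ≃ₐ[ℚ] K)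
    have h2 := card_algEquiv_K (K := K)
    omega
  -- `c₀`-fixed elements with rational square `r` make `r` a rational square
  have hrat : ∀ x : K, c₀ x = x → ∀ r : ℚ, x ^ 2 = algebraMap ℚ K r → ∃ q : ℚ, q ^ 2 = r := by
    intro x hx r hr
    obtain ⟨q, rfl⟩ := exists_eq_algebraMap_of_c₀_apply_eq hc₀ hx
    refine ⟨q, ?_⟩
    rw [← map_pow] at hr
    exact (algebraMap ℚ K).injective hr
  have hsign : ∀ x : K, ∀ r : ℚ, x ^ 2 = algebraMap ℚ K r → c₀ x = x ∨ c₀ x = -x := by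
    intro x r hr
    have h2 : (c₀ x) ^ 2 = x ^ 2 := by rw [← map_pow, hr, AlgEquiv.commutes]
    have h3 : (c₀ x - x) * (c₀ x + x) = 0 := by linear_combination h2
    rcases mul_eq_zero.mp h3 with h | h
    · exact Or.inl (by linear_combination h)
    · exact Or.inr (by linear_combination h)
  obtain ⟨w₀, hw₀⟩ := exists_sq_eq_neg_three (K := K)
  have hb' : b ^ 2 = algebraMap ℚ K (-2) := by rw [hb, map_neg, map_ofNat]
  have hw₀' : w₀ ^ 2 = algebraMap ℚ K (-3) := by rw [hw₀, map_neg, map_ofNat]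
  -- `c₀ w₀ = -w₀`
  have hcw : c₀ w₀ = -w₀ := by
    rcases hsign w₀ (-3) hw₀' with h | h
    · obtain ⟨q, hq⟩ := hrat w₀ h (-3) hw₀'
      nlinarith [sq_nonneg q]
    · exact h
  rcases hsign b (-2) hb' with h | h
  · obtain ⟨q, hq⟩ := hrat b h (-2) hb'
    nlinarith [sq_nonneg q]
  · have hfix : c₀ (b * w₀) = b * w₀ := by rw [map_mul, h, hcw, neg_mul_neg]
    have hsq : (b * w₀) ^ 2 = algebraMap ℚ K 6 := by
      rw [mul_pow, hb, hw₀, map_ofNat]; norm_num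
    obtain ⟨q, hq⟩ := hrat _ hfix 6 hsq
    exact rat_sq_ne_six q hq

/-- **Complex conjugation on `K` is `c₀`**: for every embedding `ψ : K → ℂ` and `c₀ ≠ 1`,
`conj ∘ ψ = ψ ∘ c₀` (both differ from `ψ` — `K` is totally complex, `ψ` is injective — and `K` has
exactly `[K : ℚ] = 2` complex embeddings). -/
theorem conjugate_eq_comp_c₀ {c₀ : K ≃ₐ[ℚ] K} (hc₀ : c₀ ≠ 1) (ψ : K →+* ℂ) :
    ComplexEmbedding.conjugate ψ = ψ.comp (c₀ : K →+* K) := by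
  haveI : IsTotallyComplex K := IsCyclotomicExtension.Rat.isTotallyComplex (n := 3) K (by norm_num)
  have hcard : Nat.card (K →+* ℂ) = 2 := by
    rw [Nat.card_eq_fintype_card, NumberField.Embeddings.card,
      finrank_eq_two_of_isCyclotomicExtension_three]
  have h1 : ComplexEmbedding.conjugate ψ ≠ ψ := IsTotallyComplex.complexEmbedding_not_isReal ψ
  have h2 : ψ.comp (c₀ : K →+* K) ≠ ψ := by
    intro h
    apply hc₀
    ext x
    exact ψ.injective (RingHom.congr_fun h x)
  rcases eq_or_eq_of_card_eq_two hcard h1.symm (ψ.comp (c₀ : K →+* K)) with h | h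
  · exact absurd h h2
  · exact h.symm

end Cyclotomic

/-! ## Quadratic extensions generated by a square root, and their involutions -/

section Quadratic

variable {F : Type} [Field F] {M : Type} [Field M] [Algebra F M]

/-- Ring homomorphisms out of `M = F[s]` are determined by their values on `F` and on `s`. -/
theorem ringHom_ext_of_adjoin_eq_top {s : M} (hgen : Algebra.adjoin F {s} = ⊤) {S : Type*}
    [Semiring S] {g₁ g₂ : M →+* S} (hF : ∀ x : F, g₁ (algebraMap F M x) = g₂ (algebraMap F M x))
    (hs : g₁ s = g₂ s) : g₁ = g₂ := by
  refine RingHom.ext fun x => ?_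
  have hx : x ∈ Algebra.adjoin F {s} := by rw [hgen]; exact Algebra.mem_top
  induction hx using Algebra.adjoin_induction with
  | mem y hy => rw [Set.mem_singleton_iff.mp hy]; exact hs
  | algebraMap r => exact hF r
  | add y z _ _ hy hz => rw [map_add, map_add, hy, hz]
  | mul y z _ _ hy hz => rw [map_mul, map_mul, hy, hz]

/-- **An involution extending complex conjugation is complex conjugation.**  Let `M = F[s]` with
`s² = -2`, `c ∈ Aut(M/ℚ)` with `c s = -s` restricting on `F` to `c₀`, and suppose `c₀` is complex
conjugation for every embedding of `F`.  Then `conj ∘ φ = φ ∘ c` for every embedding `φ : M → ℂ`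
(on `F` by hypothesis; `φ s` is purely imaginary since `(φ s)² = -2`). -/
theorem conjugate_eq_comp_of_sqrt [CharZero F] [CharZero M] {s : M} (hgen : Algebra.adjoin F {s} = ⊤)
    (hs : s ^ 2 = -2) (c : M ≃ₐ[ℚ] M) (hcs : c s = -s) (c₀ : F ≃ₐ[ℚ] F)
    (hcc₀ : ∀ x : F, c (algebraMap F M x) = algebraMap F M (c₀ x))
    (hconj₀ : ∀ ψ : F →+* ℂ, ComplexEmbedding.conjugate ψ = ψ.comp (c₀ : F →+* F)) (φ : M →+* ℂ) :
    ComplexEmbedding.conjugate φ = φ.comp (c : M →+* M) := by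
  refine ringHom_ext_of_adjoin_eq_top hgen (fun x => ?_) ?_
  · have h := RingHom.congr_fun (hconj₀ (φ.comp (algebraMap F M))) x
    simp only [RingHom.coe_comp, Function.comp_apply, RingHom.coe_coe] at h ⊢
    rw [hcc₀, ← h]
    rfl
  · change starRingEnd ℂ (φ s) = φ (c s)
    rw [hcs, map_neg]
    exact conj_eq_neg_of_sq_eq_neg_two (by rw [← map_pow, hs, map_neg, map_ofNat])

omit [Algebra F M] in
/-- **A totally complex field with an involution that is complex conjugation for every embedding is
CM** (the argument of Mathlib's `IsCMField.of_forall_isConj`, without its Galois hypothesis): the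
fixed field of `⟨c⟩` is totally real (`c` is complex conjugation), and `M` is a quadratic extension
of it (Artin), so `IsCMField.ofCMExtension` applies. -/
theorem isCMField_of_forall_conjugate_eq [NumberField M] [IsTotallyComplex M] (c : M ≃ₐ[ℚ] M)
    (hc1 : c ≠ 1) (hc2 : c * c = 1)
    (hconj : ∀ φ : M →+* ℂ, ComplexEmbedding.conjugate φ = φ.comp (c : M →+* M)) : IsCMField M := by
  let G : Subgroup (M ≃ₐ[ℚ] M) := Subgroup.zpowers c
  let E : Subfield M := FixedPoints.subfield G M
  have hG : Nat.card G = 2 := by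
    rw [Nat.card_zpowers]
    exact orderOf_eq_prime (by rw [pow_two, hc2]) hc1
  haveI : Finite G := Nat.finite_of_card_ne_zero (by rw [hG]; norm_num)
  haveI hFD : FiniteDimensional E M := IsGaloisGroup.finiteDimensional G E M
  haveI : Algebra.IsQuadraticExtension E M :=
    ⟨by rw [← IsGaloisGroup.card_eq_finrank G E M, hG]⟩
  haveI : IsTotallyReal E := ⟨fun w => by
    obtain ⟨W, rfl⟩ := InfinitePlace.comap_surjective (K := M) w
    dsimp only
    rw [← InfinitePlace.mk_embedding W, InfinitePlace.comap_mk, InfinitePlace.isReal_mk_iff]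
    refine ComplexEmbedding.IsConj.isReal_comp
      (σ := IsGaloisGroup.mulEquivAlgEquiv G E M ⟨c, Subgroup.mem_zpowers _⟩) ?_
    change ComplexEmbedding.conjugate W.embedding = _
    rw [hconj]
    ext x
    simp only [RingHom.coe_comp, Function.comp_apply, RingHom.coe_coe,
      IsGaloisGroup.mulEquivAlgEquiv_apply_apply]
    rfl⟩
  exact IsCMField.ofCMExtension E M

end Quadratic

/-! ## The field `L = K(√-2)` for `K = CyclotomicField 3 ℚ` -/

/-- **The CM field `L = K(√-2)` with its involution.**  For `K = ℚ(ω) = CyclotomicField 3 ℚ` and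
`c₀ ∈ Aut(K/ℚ)`, `c₀ ≠ 1` (complex conjugation), there are a number field `L ⊇ K` with
`[L : K] = 2`, an element `s ∈ L` with `s² = -2`, and an involution `c ∈ Aut(L/ℚ)` with `c s = -s`
and `c|_K = c₀`, and `L` is a CM field.  Construction: `L = K[X]/(X² + 2)` (`AdjoinRoot`; a field
since `-2` is not a square in `K`, `sq_ne_neg_two`), `s` the class of `X`, `c` the lift of
`K →c₀→ K → L`, `X ↦ -s` (`AdjoinRoot.lift`, an involution by `AdjoinRoot.algHom_ext`); `L` is
totally complex over the totally complex `K`, and CM by `isCMField_of_forall_conjugate_eq` with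
`conjugate_eq_comp_of_sqrt` and `conjugate_eq_comp_c₀`.  (So `L = ℚ(√-3, √-2)`, with maximal real
subfield `ℚ(√6)`.) -/
theorem exists_cmField_sqrt_neg_two : ∀ (c₀ : CyclotomicField 3 ℚ ≃ₐ[ℚ] CyclotomicField 3 ℚ), c₀ ≠ 1 → ∃ (L : Type) (_ : Field L) (_ : NumberField L) (_ : Algebra (CyclotomicField 3 ℚ) L) (s : L) (c : L ≃ₐ[ℚ] L), NumberField.IsCMField L ∧ s ^ 2 = -2 ∧ Module.finrank (CyclotomicField 3 ℚ) L = 2 ∧ c s = -s ∧ ∀ x : CyclotomicField 3 ℚ, c (algebraMap (CyclotomicField 3 ℚ) L x) = algebraMap (CyclotomicField 3 ℚ) L (c₀ x) := by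
  intro c₀ hc₀
  haveI hK : IsCyclotomicExtension {3} ℚ (CyclotomicField 3 ℚ) :=
    CyclotomicField.isCyclotomicExtension 3 ℚ
  -- `f = X² + 2`, irreducible over `K`
  obtain ⟨f, hf⟩ : ∃ f : (CyclotomicField 3 ℚ)[X], f = X ^ 2 - C (-2) := ⟨_, rfl⟩
  haveI hirr : Fact (Irreducible f) :=
    ⟨hf ▸ X_pow_sub_C_irreducible_of_prime Nat.prime_two fun b => sq_ne_neg_two b⟩
  have heval : ∀ {S : Type} [CommRing S] (g : CyclotomicField 3 ℚ →+* S) (x : S),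
      eval₂ g x f = x ^ 2 - g (-2) := by
    intro S _ g x
    rw [hf, eval₂_sub, eval₂_X_pow, eval₂_C]
  -- `L = K[X]/(f)` is a number field, `[L : K] = 2`
  haveI : Module.Finite (CyclotomicField 3 ℚ) (AdjoinRoot f) :=
    (AdjoinRoot.powerBasis hirr.out.ne_zero).finite
  haveI hcz : CharZero (AdjoinRoot f) :=
    charZero_of_injective_algebraMap (algebraMap (CyclotomicField 3 ℚ) (AdjoinRoot f)).injective
  haveI hNF : NumberField (AdjoinRoot f) :=
    { to_charZero := hcz
      to_finiteDimensional := Module.Finite.trans (CyclotomicField 3 ℚ) (AdjoinRoot f) }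
  have h2 : Module.finrank (CyclotomicField 3 ℚ) (AdjoinRoot f) = 2 := by
    rw [(AdjoinRoot.powerBasis hirr.out.ne_zero).finrank, AdjoinRoot.powerBasis_dim, hf,
      natDegree_X_pow_sub_C]
  -- `s = √-2`
  have hs : AdjoinRoot.root f ^ 2 = -2 := by
    have h : eval₂ (algebraMap (CyclotomicField 3 ℚ) (AdjoinRoot f)) (AdjoinRoot.root f) f = 0 :=
      AdjoinRoot.eval₂_root f
    rw [heval, map_neg, map_ofNat, sub_neg_eq_add] at h
    linear_combination h
  -- the involution `c`: `c₀` on `K`, `s ↦ -s`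
  have hev : eval₂ ((algebraMap (CyclotomicField 3 ℚ) (AdjoinRoot f)).comp
      (c₀ : CyclotomicField 3 ℚ →+* CyclotomicField 3 ℚ)) (-AdjoinRoot.root f) f = 0 := by
    rw [heval, neg_sq, hs, map_neg, map_ofNat, sub_neg_eq_add]
    norm_num
  obtain ⟨cH, hcH⟩ : ∃ cH : AdjoinRoot f →+* AdjoinRoot f, cH = AdjoinRoot.lift _ _ hev := ⟨_, rfl⟩
  have hcK : ∀ x : CyclotomicField 3 ℚ, cH (algebraMap (CyclotomicField 3 ℚ) (AdjoinRoot f) x) =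
      algebraMap (CyclotomicField 3 ℚ) (AdjoinRoot f) (c₀ x) := fun x => by
    rw [hcH]; exact AdjoinRoot.lift_of hev
  have hcs : cH (AdjoinRoot.root f) = -AdjoinRoot.root f := by rw [hcH]; exact AdjoinRoot.lift_root hev
  have hcc : ∀ x, cH (cH x) = x := by
    let g : AdjoinRoot f →ₐ[CyclotomicField 3 ℚ] AdjoinRoot f :=
      { cH.comp cH with
        commutes' := fun y => by
          change cH (cH (algebraMap (CyclotomicField 3 ℚ) (AdjoinRoot f) y)) = _
          rw [hcK, hcK, c₀_c₀_apply hc₀] }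
    have hg : g = AlgHom.id (CyclotomicField 3 ℚ) (AdjoinRoot f) := by
      refine AdjoinRoot.algHom_ext ?_
      change cH (cH (AdjoinRoot.root f)) = AdjoinRoot.root f
      rw [hcs, map_neg, hcs, neg_neg]
    exact fun x => AlgHom.congr_fun hg x
  let e : AdjoinRoot f ≃+* AdjoinRoot f :=
    RingEquiv.ofRingHom cH cH (RingHom.ext hcc) (RingHom.ext hcc)
  let c : AdjoinRoot f ≃ₐ[ℚ] AdjoinRoot f :=
    @AlgEquiv.ofRingEquiv ℚ (AdjoinRoot f) (AdjoinRoot f) _ _ _ DivisionRing.toRatAlgebra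
      DivisionRing.toRatAlgebra e fun q => by
        change cH (algebraMap ℚ (AdjoinRoot f) q) = algebraMap ℚ (AdjoinRoot f) q
        rw [eq_ratCast, map_ratCast]
  have hc : ∀ x, c x = cH x := fun _ => rfl
  have hc1 : c ≠ 1 := by
    intro h
    have h1 : c (AdjoinRoot.root f) = AdjoinRoot.root f := by rw [h, AlgEquiv.one_apply]
    rw [hc, hcs] at h1
    have h0 : AdjoinRoot.root f = 0 := by linear_combination (-(1 : AdjoinRoot f) / 2) * h1
    have h3 := hs
    rw [h0] at h3
    norm_num at h3
  have hc2 : c * c = 1 := AlgEquiv.ext fun x => hcc x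
  -- `L` is CM
  haveI : IsTotallyComplex (AdjoinRoot f) :=
    haveI : IsTotallyComplex (CyclotomicField 3 ℚ) :=
      IsCyclotomicExtension.Rat.isTotallyComplex (n := 3) (CyclotomicField 3 ℚ) (by norm_num)
    isTotallyComplex_of_algebra (CyclotomicField 3 ℚ) (AdjoinRoot f)
  have hconj : ∀ φ : AdjoinRoot f →+* ℂ, ComplexEmbedding.conjugate φ = φ.comp (c : _ →+* _) :=
    conjugate_eq_comp_of_sqrt (AdjoinRoot.adjoinRoot_eq_top (f := f)) hs c (by rw [hc, hcs]) c₀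
      (fun x => by rw [hc, hcK]) (conjugate_eq_comp_c₀ hc₀)
  exact ⟨AdjoinRoot f, inferInstance, hNF, inferInstance, AdjoinRoot.root f, c,
    isCMField_of_forall_conjugate_eq c hc1 hc2 hconj, hs, h2, by rw [hc, hcs], fun x => by rw [hc, hcK]⟩

end Summit.Langlands.Langlands.Theorems.IrregularClassicality.SplitRamifiedPrimeSqrt6

end
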